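import Mathlib
import Summits.CriticalPhenomena.PercolationContinuityZ3.Theorems.PercNearOneGluingNoHeavyLowerTailGameCount

/-!
# Section-tree domination: the adaptive form of the game-count reduction of K♯ (hp-7 gen 83)

Helper file for crux `stmt-CriticalPhenomena-4575` (`NoHeavyLowerTail`, route `PercNearOneGluingNoHeavy`), hull-port seat
`prim-hp-7` (generation 83); `--supports stmt-CriticalPhenomena-4575`.  Pure finite set theory; everything is PROVED.
Memo: `run/shared/lean/prim/prim-hp-7/FROM-prim-hp-7-g83-GAME-COUNT.md` §0 (A), (D), (H).

`…LowerTailGameCount` (p611220) proved `#X ≤ #Y` whenever `Y` dominates `X` in every quantifier game along ONE FIXED processing order of the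
coordinates (`GameCount.Dominates l X Y`), and reduced Conjecture K♯ to debtor-game domination.  Gen 83 also found that a fixed order
cannot always serve even for pure (vertex-labelled) monotone maps: a 5-pair instance on `2^[6]` fails in 144 of the 720 orders (memo §0 (D)),
while SOME order always works in every tested instance.  The natural object is therefore a *section tree*: the splitting coordinate may depend
on the node, exactly as in the Ahlswede–Daykin / sectioning recursions of gen 81–82.  `DomT G X Y` (inductive): on ground `G`, either
`G = ∅` and `∅ ∈ X → ∅ ∈ Y`, or for SOME `r ∈ G` both the doubled children and the projected children (on `G.erase r`) are in `DomT`.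
* `card_le_card_of_domT` : `DomT G X Y` with all members of `X`, `Y` inside `G` gives `#X ≤ #Y` (count identity `# = #dbl + #proj` on both sides).
* `domT_of_dominates` : list domination is the special case of a path-independent tree.
* `kSharp_ineq_of_domT`, `kSharp_of_debtorTreeDomination` : the K♯ inequality / Conjecture K♯ from tree domination of the debtor family by
  the resolved family — the weakest (most flexible) form of the gen-83 reduction.
-/

namespace Summit.CriticalPhenomena.PercolationContinuityZ3.Theorems

namespace GameCount

open Finset TypedSectioning

variable {α : Type*} [DecidableEq α]

/-- **Section-tree domination.**  `DomT G X Y`: at ground `∅` require `∅ ∈ X → ∅ ∈ Y`; otherwise SOME coordinate `r ∈ G` splits both families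
into doubled and projected children which are again dominated on `G.erase r`. -/
inductive DomT : Finset α → Finset (Finset α) → Finset (Finset α) → Prop
  | nil (X Y : Finset (Finset α)) (h : (∅ : Finset α) ∈ X → (∅ : Finset α) ∈ Y) : DomT ∅ X Y
  | step (G : Finset α) (X Y : Finset (Finset α)) (r : α) (hr : r ∈ G)
      (h₁ : DomT (G.erase r) (dbl X r) (dbl Y r)) (h₂ : DomT (G.erase r) (proj X r) (proj Y r)) : DomT G X Y

/-- Members of the doubled child lie inside the ground minus the split coordinate. -/
theorem subset_erase_of_mem_dbl {X : Finset (Finset α)} {G : Finset α} {r : α}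
    (hX : ∀ S ∈ X, S ⊆ G) {S : Finset α} (hS : S ∈ dbl X r) : S ⊆ G.erase r := by
  rw [mem_dbl] at hS
  intro x hx
  rw [mem_erase]
  exact ⟨fun h => hS.2.1 (h ▸ hx), hX S hS.1 hx⟩

/-- Members of the projected child lie inside the ground minus the split coordinate. -/
theorem subset_erase_of_mem_proj {X : Finset (Finset α)} {G : Finset α} {r : α}
    (hX : ∀ S ∈ X, S ⊆ G) {S : Finset α} (hS : S ∈ proj X r) : S ⊆ G.erase r := by
  rw [mem_proj] at hS
  obtain ⟨T, hT, rfl⟩ := hS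
  intro x hx
  rw [mem_erase] at hx ⊢
  exact ⟨hx.1, hX T hT hx.2⟩

/-- A family of subsets of `∅` has `≤ 1` members, namely possibly `∅`. -/
theorem card_eq_ite_of_subset_empty (X : Finset (Finset α)) (hX : ∀ S ∈ X, S ⊆ (∅ : Finset α)) :
    #X = if (∅ : Finset α) ∈ X then 1 else 0 := by
  rw [card_eq_gameCount [] X (by simpa using hX)]
  rfl

/-- **Tree domination bounds the cardinality** (hp-7 gen 83): if all members of `X` and `Y` lie in `G` and `DomT G X Y`, then `#X ≤ #Y`. -/
theorem card_le_card_of_domT {G : Finset α} {X Y : Finset (Finset α)} (h : DomT G X Y)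
    (hX : ∀ S ∈ X, S ⊆ G) (hY : ∀ S ∈ Y, S ⊆ G) : #X ≤ #Y := by
  induction h with
  | nil X Y h =>
    rw [card_eq_ite_of_subset_empty X hX, card_eq_ite_of_subset_empty Y hY]
    by_cases hx : (∅ : Finset α) ∈ X
    · rw [if_pos hx, if_pos (h hx)]
    · rw [if_neg hx]; exact Nat.zero_le _
  | step G X Y r hr h₁ h₂ ih₁ ih₂ =>
    rw [card_eq_card_dbl_add_card_proj X r, card_eq_card_dbl_add_card_proj Y r]
    exact Nat.add_le_add (ih₁ (fun S hS => subset_erase_of_mem_dbl hX hS) (fun S hS => subset_erase_of_mem_dbl hY hS))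
      (ih₂ (fun S hS => subset_erase_of_mem_proj hX hS) (fun S hS => subset_erase_of_mem_proj hY hS))

/-- List domination along `l` gives tree domination on `l.toFinset` (for a duplicate-free list). -/
theorem domT_of_dominates {l : List α} (hl : l.Nodup) {X Y : Finset (Finset α)} (h : Dominates l X Y) :
    DomT l.toFinset X Y := by
  induction l generalizing X Y with
  | nil => unfold Dominates at h; simpa using DomT.nil X Y h
  | cons r l ih =>
    unfold Dominates at h
    have hnd : l.Nodup := (List.nodup_cons.mp hl).2
    have hrl : r ∉ l := (List.nodup_cons.mp hl).1
    have hG : (r :: l).toFinset.erase r = l.toFinset := by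
      rw [List.toFinset_cons, erase_insert (by simpa using hrl)]
    refine DomT.step _ X Y r (by simp) ?_ ?_
    · rw [hG]; exact ih hnd h.1
    · rw [hG]; exact ih hnd h.2

end GameCount

namespace GeneratedDonors

open Finset OrientedAntipodalHall AntipodalStrongHarris AntipodalStrongHarris.Lab GameCount

variable {α : Type} [Fintype α] [DecidableEq α]

/-- **K♯ from section-tree domination** (hp-7 gen 83): if the resolved family dominates the debtor family along SOME section tree on the
full coordinate set, the K♯ inequality holds at `(g, h)`. -/
theorem kSharp_ineq_of_domT (g h : Finset α → Lab 3) (hdom : DomT (univ : Finset α) (debtors g h) (resolved g h)) :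
    #{q ∈ (univ : Finset (Finset α)) | IsCharged 3 g h q} ≤
      #{q ∈ (univ : Finset (Finset α)) | (g q = top ∧ h (univ \ q) = bot) ∨ (g (univ \ q) = top ∧ h q = bot)} :=
  kSharp_ineq_of_card_debtors_le_card_resolved g h
    (card_le_card_of_domT hdom (fun S _ => subset_univ S) (fun S _ => subset_univ S))

/-- **Conjecture K♯ follows from debtor-game tree domination** (hp-7 gen 83, adaptive form): if for every pair of monotone labellings the
resolved family dominates the debtor family along some section tree, then `KSharp 3`. -/
theorem kSharp_of_debtorTreeDomination
    (H : ∀ (α : Type) [Fintype α] [DecidableEq α] (g h : Finset α → Lab 3),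
      (∀ ⦃X Y : Finset α⦄, X ⊆ Y → g X ≤ g Y) → (∀ ⦃X Y : Finset α⦄, X ⊆ Y → h X ≤ h Y) →
        DomT (univ : Finset α) (debtors g h) (resolved g h)) :
    KSharp 3 := by
  intro α _ _ g h hg hh
  exact kSharp_ineq_of_domT g h (H α g h hg hh)

end GeneratedDonors

/-! ### Appendix (gen 83): `Dominates` is word-wise domination of the quantifier games -/

namespace GameCount

open Finset TypedSectioning

variable {α : Type*} [DecidableEq α]

/-- The quantifier game along the processing list `l` with word `w` (`true` = projection / `∃`, `false` = doubling / `∀`; the head of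
`l` is processed FIRST, i.e. it is the innermost quantifier): `Wins l w X` iff the iterated child of `X` contains `∅`.  Words shorter
than `l` never win. -/
def Wins : List α → List Bool → Finset (Finset α) → Prop
  | [], _, X => (∅ : Finset α) ∈ X
  | _ :: _, [], _ => False
  | r :: l, b :: w, X => Wins l w (if b then proj X r else dbl X r)

/-- **`Dominates` = word-wise domination** (hp-7 gen 83): `Y` dominates `X` along `l` iff every quantifier word won by `X` is won by `Y`
(memo: `M_w(X) ⟹ M_w(Y)` for all `w`). -/
theorem dominates_iff_forall_wins (l : List α) (X Y : Finset (Finset α)) :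
    Dominates l X Y ↔ ∀ w : List Bool, Wins l w X → Wins l w Y := by
  induction l generalizing X Y with
  | nil =>
    unfold Dominates
    constructor
    · intro h w hw
      cases w with
      | nil => exact h hw
      | cons b w => exact h hw
    · intro h hx
      exact h [] hx
  | cons r l ih =>
    unfold Dominates
    constructor
    · rintro ⟨h₁, h₂⟩ w hw
      cases w with
      | nil => exact hw.elim
      | cons b w =>
        cases b with
        | true =>
          change Wins l w (if true = true then proj X r else dbl X r) at hw
          change Wins l w (if true = true then proj Y r else dbl Y r)
          rw [if_pos rfl] at hw ⊢
          exact (ih _ _).mp h₂ w hw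
        | false =>
          change Wins l w (if false = true then proj X r else dbl X r) at hw
          change Wins l w (if false = true then proj Y r else dbl Y r)
          rw [if_neg Bool.false_ne_true] at hw ⊢
          exact (ih _ _).mp h₁ w hw
    · intro h
      refine ⟨(ih _ _).mpr fun w hw => ?_, (ih _ _).mpr fun w hw => ?_⟩
      · have := h (false :: w)
        change Wins l w (if false = true then proj X r else dbl X r) → Wins l w (if false = true then proj Y r else dbl Y r) at this
        rw [if_neg Bool.false_ne_true] at this
        exact this hw
      · have := h (true :: w)
        change Wins l w (if true = true then proj X r else dbl X r) → Wins l w (if true = true then proj Y r else dbl Y r) at this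
        rw [if_pos rfl] at this
        exact this hw

end GameCount

/-! ### Appendix 2 (gen 83): monotonicity of tree domination (sandwiching) -/

namespace GameCount

open Finset TypedSectioning

variable {α : Type*} [DecidableEq α]

/-- **Tree domination is monotone**: shrinking the dominated family and enlarging the dominating family preserves `DomT`.  (Use: a
domination of `Debt` by a SUB-family of the resolved sets — e.g. the hull of the generated differences — already gives K♯.) -/
theorem DomT.mono {G : Finset α} {X Y : Finset (Finset α)} (h : DomT G X Y) {X' Y' : Finset (Finset α)}
    (hX : X' ⊆ X) (hY : Y ⊆ Y') : DomT G X' Y' := by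
  induction h generalizing X' Y' with
  | nil X Y h => exact DomT.nil X' Y' fun hx => hY (h (hX hx))
  | step G X Y r hr h₁ h₂ ih₁ ih₂ =>
    exact DomT.step G X' Y' r hr (ih₁ (dbl_mono hX r) (dbl_mono hY r)) (ih₂ (proj_mono hX r) (proj_mono hY r))

/-- A family dominates itself along any section tree built from a list enumerating the ground set (existence of SOME section tree). -/
theorem domT_self (l : List α) (hl : l.Nodup) (X : Finset (Finset α)) : DomT l.toFinset X X :=
  domT_of_dominates hl (dominates_refl l X)

/-- A sub-family is tree-dominated by any super-family (on the ground set enumerated by a duplicate-free list). -/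
theorem domT_of_subset (l : List α) (hl : l.Nodup) {X Y : Finset (Finset α)} (h : X ⊆ Y) : DomT l.toFinset X Y :=
  (domT_self l hl Y).mono h (subset_refl Y)

end GameCount

namespace GeneratedDonors

open Finset OrientedAntipodalHall AntipodalStrongHarris AntipodalStrongHarris.Lab GameCount

variable {α : Type} [Fintype α] [DecidableEq α]

/-- **K♯ from tree domination by any resolved sub-family** (hp-7 gen 83): if some family `Y` of resolved sets (e.g. the hull of the
generated differences) tree-dominates the debtor family, the K♯ inequality holds at `(g, h)`. -/
theorem kSharp_ineq_of_domT_subfamily (g h : Finset α → Lab 3) (Y : Finset (Finset α)) (hY : Y ⊆ resolved g h)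
    (hdom : DomT (univ : Finset α) (debtors g h) Y) :
    #{q ∈ (univ : Finset (Finset α)) | IsCharged 3 g h q} ≤
      #{q ∈ (univ : Finset (Finset α)) | (g q = top ∧ h (univ \ q) = bot) ∨ (g (univ \ q) = top ∧ h q = bot)} :=
  kSharp_ineq_of_domT g h (hdom.mono (subset_refl _) hY)

end GeneratedDonors

end Summit.CriticalPhenomena.PercolationContinuityZ3.Theorems
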